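import Summits.QuantumFields.BalabanUV.Beta.GAN24.ArrowScalingInv
import Summits.QuantumFields.BalabanUV.Beta.GAN24.ArrowSchurEntries
import Summits.QuantumFields.BalabanUV.Beta.GAN24.ArrowAnchorRealCapRadius
import Summits.QuantumFields.BalabanUV.Beta.GAN24.AliasFibreBridge
import Summits.QuantumFields.BalabanUV.Beta.GAN24.CapacitanceScalarDictionary

/-!
# `BalabanUV.Beta.GAN24.ArrowAnchorRealSchur` — binder row G-an2-4 / (CONV-C), road P1-fibre, p1 row **P1-L10** `FibreStrip` ((I3′)), leaf-16's cut (M4)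
# `L10-CUT-M4.md` row **F5 `ArrowAnchorReal`** (OUTER ANCHOR), PART (iv′): THE SCHUR COMPLEMENT OF THE OUTER-SCALED ARROW MATRIX AT THE REAL ANCHOR
# IS THE (SIGN-TWISTED) OUTER-SCALED CAPACITANCE MATRIX

NOT IN PRINT; OUR PROOF ATTEMPT.  HONEST FRAMING (cell contract, verbatim): «discharging `BetaPertH` makes Bałaban's UV stability UNCONDITIONAL — a real
constructive-QFT result; it is NOT the continuum limit and NOT the Clay problem.»  HONEST DEPENDENCY (verbatim): «continuum YM on T⁴ ⇐ BetaPertH ∧ nine spine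
estimates (0/9 proved); BetaPertH ⇐ (D1) ∧ (D4) ∧ CAP+tail; G-an2-4 gates asym, D1 and NE2/3/4.»  [folklore] finite-dimensional linear algebra over F1c/F1d/F1e
(`ArrowScaling`, `ArrowUnitBlock`, `ArrowScalingInv`), E1 (`BorderedFrameInverse`), leaf-12's `ArrowSchurEntries` / `ArrowAnchorRealCapRadius`, T00 `AliasObjects`
and leaf-06's `AliasFibreBridge` — every input BY NAME; no cited fact, no wall binder, no `def`, no `def … : Prop`.  NOT summit progress: nothing of (CONV-C)'s
K-slot `GAN24.CombesThomas.ConvCK 3 Lc` is discharged here; 0 wall binders; NOT `BetaPertH`, NOT continuum, NOT Clay.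

## What is proved (every `D`, `N ≥ 1`, `q ∈ [−π, π]^D ∖ {0}`; `X = outerArrow N q (ofRealVec q)`, `r₀ = radO N q 0`)
§1 The EXPLICIT INVERSE ENTRIES of the unit KKT block (`uᴴu = 1`): `(unitKKT u)⁻¹ = [[(1 − u uᴴ)/2, u], [−uᴴ, 0]]` entry by entry
   (E1's `frameInv` with `P⁺ = (2·1 − uuᴴ)⁻¹ − uuᴴ = (1 − uuᴴ)/2`).
§2 The blocks of `X` are `unitKKT (unitSym N q m)` (F1e's bridge) and the inverse-block entries in T00's alias currency:
   `((X.T m)⁻¹)_{A_κ A_l} = (δ_{κl} − ∂_{mκ} ∂♭_{ml}/L_m)/2`, `(…)_{A_κ μ} = (N/r_m)·∂_{mκ}`, `(…)_{μ A_l} = −(N/r_m)·∂♭_{ml}`, `(…)_{μμ} = 0`.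
§3 **THE SCHUR COMPLEMENT IS THE OUTER-SCALED CAPACITANCE MATRIX UP TO A ROW SIGN**:
   `ArrowNorms.capS X.T (borU X) (borV X) = diagonal (−1 on φ, +1 on c) * capSR N q r₀` (`capS_outer_eq`), hence
§4 `IsUnit (capS …)` and **`‖(capS …)⁻¹‖ ≤ bCapO D`** (`capS_outer_ape`) — the Schur input `(hS, hb)` of `ArrowNorms.isUnit_bordered` for row F5.
Unit `b2b-balaban-gan24-formalise-leaf-12` (G-an2-4 formalisation swarm, leaf prover 12, gen 7), 2026-08-20.  Value = kernel bookkeeping toward (I3′), NOT summit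
progress.
-/

noncomputable section

open Matrix Complex Finset
open scoped Matrix.Norms.L2Operator BigOperators Real ComplexConjugate

namespace Summit.QuantumFields.BalabanUV.Beta.GAN24.ArrowAnchorRealSchur

open Literature.MathematicalPhysics.QuantumFieldTheory.Balaban1983to89.B4Strip (ofRealVec)
open Literature.Probability.LatticeModels (TorusSite)
open FibreSymbols (dhat dflat lapSym)
open FibreDFT (kFine)
open FibreArrow (chiHat sflat boxS boxSs)
open AliasObjects (sAl SAl sbAl chiAl wAl dAl dbAl LAl cap capP capV capW reg_eq_univ)
open AliasFibreBridge (sflat_eq_sbAl boxS_eq_SAl chiHat_eq_chiAl boxSs_eq_SAl_mul_sAl)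
open AliasWeights (kfine)
open AliasWeightsSum (lapR)
open CapacitanceScalarDictionary (LAl_ofRealVec LAl_ofRealVec_ne_zero)
open BorderedFrameInverse (uuH uuH_mul_uuH frameInv pinvT)
open ArrowUnitBlock (unitKKT inv_unitKKT star_dotProduct_self_eq_one_of_sum)
open ArrowOperator (Loc ArrowData arrowMat borU borV)
open ArrowNorms (capS)
open ArrowScaling (outerArrow scaledArrow radO radO_pos unitSym uBlock sum_norm_sq_unitSym scaledArrow_T_ofRealVec scaledArrow_wE scaledArrow_wG
  scaledArrow_wM scaledArrow_wQ kFine_ofRealVec_eq dflat_ofRealVec_eq_conj sq_div_radO_mul_lapR isUnit_diagonal_of_ne_zero)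
open ArrowScalingInv (uBlock_eq_unitKKT)
open ArrowSchurEntries (capS_arrow_inl_inl capS_arrow_inl_inr capS_arrow_inr_inl capS_arrow_inr_inr)
open ArrowAnchorRealCap (rad)
open ArrowAnchorRealCapRadius (rowScaleR colScaleR capSR bCapO isUnit_capSR norm_capSR_inv_inl_inl_le norm_capSR_inv_inl_inr_le
  norm_capSR_inv_inr_inl_le norm_capSR_inv_inr_inr_le two_div_pi_mul_rad_le_radO)
open CapacitanceEndpointBlocks (cPP cPc ccc)
open BorderedFrameInverseBlocks (opNorm_le_sum_entries)

/-! ## §1 Explicit inverse entries of the unit KKT block -/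

section UnitKKTInv

variable {ι : Type*} [Fintype ι] [DecidableEq ι] {u : ι → ℂ}

omit [Fintype ι] in
/-- [folklore] `2(1 − uuᴴ) + uuᴴ = 2·1 − uuᴴ`. -/
theorem two_smul_sub_add_uuH (u : ι → ℂ) : (2 : ℂ) • (1 - uuH u) + uuH u = (2 : ℂ) • (1 : Matrix ι ι ℂ) - uuH u := by
  ext i j
  simp only [Matrix.add_apply, Matrix.sub_apply, Matrix.smul_apply, smul_eq_mul]
  ring

/-- [folklore] `(2·1 − uuᴴ) · ((1 + uuᴴ)/2) = 1` for a unit vector (`uuᴴ` idempotent). -/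
theorem two_sub_uuH_mul (hu : star u ⬝ᵥ u = 1) :
    ((2 : ℂ) • (1 : Matrix ι ι ℂ) - uuH u) * ((1 / 2 : ℂ) • (1 + uuH u)) = 1 := by
  rw [Matrix.mul_smul, Matrix.sub_mul, Matrix.mul_add, Matrix.mul_add, Matrix.smul_mul, Matrix.smul_mul, Matrix.one_mul, Matrix.one_mul,
    Matrix.mul_one, uuH_mul_uuH hu]
  ext i j
  simp only [Matrix.smul_apply, Matrix.sub_apply, Matrix.add_apply, smul_eq_mul, Matrix.one_apply]
  ring

/-- [folklore] E1's pseudo-inverse of the transverse block of the unit KKT block: `P⁺ = (1 + uuᴴ)/2 − uuᴴ`. -/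
theorem pinvT_unit (hu : star u ⬝ᵥ u = 1) : pinvT ((2 : ℂ) • (1 - uuH u)) u = (1 / 2 : ℂ) • (1 + uuH u) - uuH u := by
  rw [pinvT, two_smul_sub_add_uuH, Matrix.inv_eq_right_inv (two_sub_uuH_mul hu)]

/-- [folklore] `((unitKKT u)⁻¹)_{κl} = (δ_{κl} − u_κ conj(u_l))/2`. -/
theorem inv_unitKKT_inl_inl (hu : star u ⬝ᵥ u = 1) (κ l : ι) :
    (unitKKT u)⁻¹ (Sum.inl κ) (Sum.inl l) = ((if κ = l then 1 else 0) - u κ * conj (u l)) / 2 := by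
  rw [inv_unitKKT hu, frameInv, fromBlocks_apply₁₁, pinvT_unit hu]
  simp only [Matrix.sub_apply, Matrix.smul_apply, Matrix.add_apply, Matrix.one_apply, uuH, vecMulVec_apply, Pi.star_apply, Complex.star_def,
    smul_eq_mul]
  ring

/-- [folklore] `((unitKKT u)⁻¹)_{κ μ} = u_κ`. -/
theorem inv_unitKKT_inl_inr (hu : star u ⬝ᵥ u = 1) (κ : ι) (v : Unit) : (unitKKT u)⁻¹ (Sum.inl κ) (Sum.inr v) = u κ := by
  rw [inv_unitKKT hu, frameInv, fromBlocks_apply₁₂]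
  simp

/-- [folklore] `((unitKKT u)⁻¹)_{μ l} = −conj(u_l)`. -/
theorem inv_unitKKT_inr_inl (hu : star u ⬝ᵥ u = 1) (v : Unit) (l : ι) : (unitKKT u)⁻¹ (Sum.inr v) (Sum.inl l) = -conj (u l) := by
  rw [inv_unitKKT hu, frameInv, fromBlocks_apply₂₁]
  simp

/-- [folklore] `((unitKKT u)⁻¹)_{μ μ} = 0`. -/
theorem inv_unitKKT_inr_inr (hu : star u ⬝ᵥ u = 1) (v w : Unit) : (unitKKT u)⁻¹ (Sum.inr v) (Sum.inr w) = 0 := by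
  rw [inv_unitKKT hu, frameInv, fromBlocks_apply₂₂]
  simp

end UnitKKTInv

/-! ## §2 The outer anchor: blocks and inverse-block entries in the alias currency -/

variable {D : ℕ} {N : ℕ} [NeZero N] {q : Fin D → ℝ}

/-- [folklore] F1e's bridge at the outer anchor: `X.T m = unitKKT (unitSym N q m)`. -/
theorem outer_T_eq (hq : ∀ i, |q i| ≤ π) (hq0 : q ≠ 0) (m : TorusSite D N) :
    (outerArrow N q (ofRealVec q)).T m = unitKKT (unitSym N q m) := by
  rw [outerArrow, scaledArrow_T_ofRealVec (radO_pos hq hq0), uBlock_eq_unitKKT]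

/-- [folklore] `unitSym N q m` is a unit vector in the `⬝ᵥ` currency. -/
theorem unitSym_unit (hq : ∀ i, |q i| ≤ π) (hq0 : q ≠ 0) (m : TorusSite D N) : star (unitSym N q m) ⬝ᵥ unitSym N q m = 1 :=
  star_dotProduct_self_eq_one_of_sum (sum_norm_sq_unitSym (radO_pos hq hq0 m))

/-- [folklore] Dictionary: `unitSym N q m κ = (N/r_m)·∂_{mκ}` with T00's `dAl` at `p = ofRealVec q`. -/
theorem unitSym_eq (q : Fin D → ℝ) (m : TorusSite D N) (κ : Fin D) :
    unitSym N q m κ = (((N : ℝ) / radO N q m : ℝ) : ℂ) * dAl N (ofRealVec q) m κ := by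
  show _ = _ * dhat (kFine (ofRealVec q) m) κ
  rw [kFine_ofRealVec_eq]; rfl

/-- [folklore] Dictionary: `conj (unitSym N q m l) = (N/r_m)·∂♭_{ml}`. -/
theorem conj_unitSym_eq (q : Fin D → ℝ) (m : TorusSite D N) (l : Fin D) :
    conj (unitSym N q m l) = (((N : ℝ) / radO N q m : ℝ) : ℂ) * dbAl N (ofRealVec q) m l := by
  show conj ((((N : ℝ) / radO N q m : ℝ) : ℂ) * dhat (ofRealVec (kfine N q m)) l) = _ * dflat (kFine (ofRealVec q) m) l
  rw [map_mul, Complex.conj_ofReal, ← dflat_ofRealVec_eq_conj, kFine_ofRealVec_eq]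

/-- [folklore] THE NORMALISATION in T00's currency: `(N/r_m)² = 1/L_m`. -/
theorem sq_scale_eq_inv_LAl (hq : ∀ i, |q i| ≤ π) (hq0 : q ≠ 0) (m : TorusSite D N) :
    (((N : ℝ) / radO N q m : ℝ) : ℂ) ^ 2 = (LAl N (ofRealVec q) m)⁻¹ := by
  have h1 : (((N : ℝ) / radO N q m : ℝ) : ℂ) ^ 2 * LAl N (ofRealVec q) m = 1 := by
    rw [LAl_ofRealVec, ← Complex.ofReal_pow, ← Complex.ofReal_mul, sq_div_radO_mul_lapR (radO_pos hq hq0 m), Complex.ofReal_one]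
  exact eq_inv_of_mul_eq_one_left h1

/-- [folklore] `N²/r_m² = 1/L_m` (the `EL`-row scale). -/
theorem scale_two_eq (hq : ∀ i, |q i| ≤ π) (hq0 : q ≠ 0) (m : TorusSite D N) :
    (((N : ℝ) ^ 2 / radO N q m ^ 2 : ℝ) : ℂ) = (LAl N (ofRealVec q) m)⁻¹ := by
  rw [← div_pow, Complex.ofReal_pow, sq_scale_eq_inv_LAl hq hq0]

omit [NeZero N] in
/-- [folklore] `N³/r_m³ = (N/r_m)³` (the `G`-row scale). -/
theorem scale_three_eq [NeZero N] (q : Fin D → ℝ) (m : TorusSite D N) :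
    (((N : ℝ) ^ 3 / radO N q m ^ 3 : ℝ) : ℂ) = (((N : ℝ) / radO N q m : ℝ) : ℂ) ^ 3 := by
  rw [← div_pow, Complex.ofReal_pow]

/-- [folklore] `((X.T m)⁻¹)_{A_κ A_l} = (δ_{κl} − ∂_{mκ}∂♭_{ml}/L_m)/2`. -/
theorem outer_Tinv_inl_inl (hq : ∀ i, |q i| ≤ π) (hq0 : q ≠ 0) (m : TorusSite D N) (κ l : Fin D) :
    ((outerArrow N q (ofRealVec q)).T m)⁻¹ (Sum.inl κ) (Sum.inl l) =
      ((if κ = l then 1 else 0) - dAl N (ofRealVec q) m κ * dbAl N (ofRealVec q) m l / LAl N (ofRealVec q) m) / 2 := by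
  rw [outer_T_eq hq hq0, inv_unitKKT_inl_inl (unitSym_unit hq hq0 m), unitSym_eq, conj_unitSym_eq,
    show ∀ (c a b : ℂ), c * a * (c * b) = c ^ 2 * (a * b) from fun c a b => by ring, sq_scale_eq_inv_LAl hq hq0, inv_mul_eq_div]

/-- [folklore] `((X.T m)⁻¹)_{A_κ μ} = (N/r_m)·∂_{mκ}`. -/
theorem outer_Tinv_inl_inr (hq : ∀ i, |q i| ≤ π) (hq0 : q ≠ 0) (m : TorusSite D N) (κ : Fin D) (v : Unit) :
    ((outerArrow N q (ofRealVec q)).T m)⁻¹ (Sum.inl κ) (Sum.inr v) = (((N : ℝ) / radO N q m : ℝ) : ℂ) * dAl N (ofRealVec q) m κ := by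
  rw [outer_T_eq hq hq0, inv_unitKKT_inl_inr (unitSym_unit hq hq0 m), unitSym_eq]

/-- [folklore] `((X.T m)⁻¹)_{μ A_l} = −(N/r_m)·∂♭_{ml}`. -/
theorem outer_Tinv_inr_inl (hq : ∀ i, |q i| ≤ π) (hq0 : q ≠ 0) (m : TorusSite D N) (v : Unit) (l : Fin D) :
    ((outerArrow N q (ofRealVec q)).T m)⁻¹ (Sum.inr v) (Sum.inl l) = -((((N : ℝ) / radO N q m : ℝ) : ℂ) * dbAl N (ofRealVec q) m l) := by
  rw [outer_T_eq hq hq0, inv_unitKKT_inr_inl (unitSym_unit hq hq0 m), conj_unitSym_eq]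

/-- [folklore] `((X.T m)⁻¹)_{μ μ} = 0`. -/
theorem outer_Tinv_inr_inr (hq : ∀ i, |q i| ≤ π) (hq0 : q ≠ 0) (m : TorusSite D N) (v w : Unit) :
    ((outerArrow N q (ofRealVec q)).T m)⁻¹ (Sum.inr v) (Sum.inr w) = 0 := by
  rw [outer_T_eq hq hq0, inv_unitKKT_inr_inr (unitSym_unit hq hq0 m)]

/-! ## §3 The Schur complement, entry by entry, is the sign-twisted outer-scaled capacitance matrix -/

/-- [folklore] Entries of `capSR`: `ρ_i · Cap_{ij} · σ_j`. -/
theorem capSR_apply (q : Fin D → ℝ) (r0 : ℝ) (i j : Fin D ⊕ Unit) :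
    capSR N q r0 i j = ((rowScaleR (D := D) N r0 i : ℝ) : ℂ) * cap N (ofRealVec q) i j * ((colScaleR (D := D) N r0 j : ℝ) : ℂ) := by
  rw [capSR, mul_diagonal, diagonal_mul]

/-- [folklore] The `(Q_κ, φ_l)` entry: `capS_{Q_κ φ_l} = −capSR_{Q_κ φ_l}`. -/
theorem capS_outer_inl_inl (hN : 1 ≤ N) (hq : ∀ i, |q i| ≤ π) (hq0 : q ≠ 0) (κ l : Fin D) :
    capS (outerArrow N q (ofRealVec q)).T (borU (outerArrow N q (ofRealVec q))) (borV (outerArrow N q (ofRealVec q))) (Sum.inl κ) (Sum.inl l) =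
      -capSR N q (radO N q 0) (Sum.inl κ) (Sum.inl l) := by
  have hL := LAl_ofRealVec_ne_zero hN hq hq0
  rw [capS_arrow_inl_inl]
  simp_rw [outer_Tinv_inl_inl hq hq0]
  rw [capSR_apply, AliasObjects.cap_inl_inl, capP, reg_eq_univ N _ hL, Finset.mul_sum, Finset.sum_mul]
  congr 1
  refine Finset.sum_congr rfl fun m _ => ?_
  simp only [outerArrow, scaledArrow_wQ, scaledArrow_wE, boxSs_eq_SAl_mul_sAl, chiHat_eq_chiAl, sflat_eq_sbAl, ArrowAnchorRealCapRadius.rowScaleR_inl,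
    ArrowAnchorRealCapRadius.colScaleR_inl, wAl]
  rw [scale_two_eq hq hq0]
  have hLm := hL m
  push_cast
  field_simp

/-- [folklore] The `(Q_κ, c)` entry: `capS_{Q_κ c} = −capSR_{Q_κ c}`. -/
theorem capS_outer_inl_inr (hN : 1 ≤ N) (hq : ∀ i, |q i| ≤ π) (hq0 : q ≠ 0) (κ : Fin D) (v : Unit) :
    capS (outerArrow N q (ofRealVec q)).T (borU (outerArrow N q (ofRealVec q))) (borV (outerArrow N q (ofRealVec q))) (Sum.inl κ) (Sum.inr v) =
      -capSR N q (radO N q 0) (Sum.inl κ) (Sum.inr v) := by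
  have hL := LAl_ofRealVec_ne_zero hN hq hq0
  rw [capS_arrow_inl_inr]
  simp_rw [outer_Tinv_inl_inr hq hq0]
  rw [capSR_apply, AliasObjects.cap_inl_inr, capV, reg_eq_univ N _ hL, Finset.mul_sum, Finset.sum_mul]
  congr 1
  refine Finset.sum_congr rfl fun m _ => ?_
  simp only [outerArrow, scaledArrow_wQ, scaledArrow_wG, boxSs_eq_SAl_mul_sAl, chiHat_eq_chiAl, ArrowAnchorRealCapRadius.rowScaleR_inl,
    ArrowAnchorRealCapRadius.colScaleR_inr, wAl]
  rw [scale_three_eq]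
  have hc := sq_scale_eq_inv_LAl hq hq0 m
  have hLm := hL m
  have hc4 : (((N : ℝ) / radO N q m : ℝ) : ℂ) * (((N : ℝ) / radO N q m : ℝ) : ℂ) ^ 3 = (LAl N (ofRealVec q) m)⁻¹ ^ 2 := by
    rw [← hc]; ring
  calc _ = ((((N : ℝ) ^ (D + 1))⁻¹ : ℝ) : ℂ) * ((radO N q 0 ^ 3 / (N : ℝ) ^ 3 : ℝ) : ℂ) *
        (SAl N (ofRealVec q) m * chiAl N (ofRealVec q) m * sAl N (ofRealVec q) m κ * dAl N (ofRealVec q) m κ) *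
          ((((N : ℝ) / radO N q m : ℝ) : ℂ) * (((N : ℝ) / radO N q m : ℝ) : ℂ) ^ 3) := by
        push_cast; ring
    _ = _ := by rw [hc4]; field_simp

/-- [folklore] The `(M, φ_l)` entry: `capS_{M φ_l} = +capSR_{M φ_l}`. -/
theorem capS_outer_inr_inl (hN : 1 ≤ N) (hq : ∀ i, |q i| ≤ π) (hq0 : q ≠ 0) (v : Unit) (l : Fin D) :
    capS (outerArrow N q (ofRealVec q)).T (borU (outerArrow N q (ofRealVec q))) (borV (outerArrow N q (ofRealVec q))) (Sum.inr v) (Sum.inl l) =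
      capSR N q (radO N q 0) (Sum.inr v) (Sum.inl l) := by
  have hL := LAl_ofRealVec_ne_zero hN hq hq0
  rw [capS_arrow_inr_inl]
  simp_rw [outer_Tinv_inr_inl hq hq0]
  rw [capSR_apply, AliasObjects.cap_inr_inl, capW, reg_eq_univ N _ hL, Finset.mul_sum, Finset.sum_mul, ← Finset.sum_neg_distrib]
  refine Finset.sum_congr rfl fun m _ => ?_
  simp only [outerArrow, scaledArrow_wM, scaledArrow_wE, boxS_eq_SAl, chiHat_eq_chiAl, sflat_eq_sbAl, ArrowAnchorRealCapRadius.rowScaleR_inr,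
    ArrowAnchorRealCapRadius.colScaleR_inl, wAl]
  rw [scale_two_eq hq hq0]
  have hc := sq_scale_eq_inv_LAl hq hq0 m
  have hLm := hL m
  calc _ = ((radO N q 0 / (N : ℝ) ^ (D + 1) : ℝ) : ℂ) * ((radO N q 0 ^ 2 / (N : ℝ) ^ 3 : ℝ) : ℂ) *
        (SAl N (ofRealVec q) m * chiAl N (ofRealVec q) m * dbAl N (ofRealVec q) m l * sbAl N (ofRealVec q) m l) *
          (LAl N (ofRealVec q) m)⁻¹ * (((N : ℝ) / radO N q m : ℝ) : ℂ) ^ 2 := by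
        push_cast; ring
    _ = _ := by rw [hc]; field_simp

omit [NeZero N] in
/-- [folklore] The `(M, c)` entry: `capS_{M c} = 0 = capSR_{M c}`. -/
theorem capS_outer_inr_inr [NeZero N] (hq : ∀ i, |q i| ≤ π) (hq0 : q ≠ 0) (v w : Unit) :
    capS (outerArrow N q (ofRealVec q)).T (borU (outerArrow N q (ofRealVec q))) (borV (outerArrow N q (ofRealVec q))) (Sum.inr v) (Sum.inr w) =
      capSR N q (radO N q 0) (Sum.inr v) (Sum.inr w) := by
  rw [capS_arrow_inr_inr]
  simp_rw [outer_Tinv_inr_inr hq hq0]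
  rw [capSR_apply, AliasObjects.cap_inr_inr]
  simp

/-- [folklore] **THE SCHUR COMPLEMENT OF THE OUTER-SCALED ARROW MATRIX AT THE REAL ANCHOR**:
`capS X.T (borU X) (borV X) = diag(−1 on φ, +1 on c) · capSR N q r₀` (`X = outerArrow N q (ofRealVec q)`, `r₀ = radO N q 0`). -/
theorem capS_outer_eq (hN : 1 ≤ N) (hq : ∀ i, |q i| ≤ π) (hq0 : q ≠ 0) :
    capS (outerArrow N q (ofRealVec q)).T (borU (outerArrow N q (ofRealVec q))) (borV (outerArrow N q (ofRealVec q))) =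
      diagonal (Sum.elim (fun _ : Fin D => (-1 : ℂ)) (fun _ : Unit => 1)) * capSR N q (radO N q 0) := by
  ext i j
  rw [diagonal_mul]
  rcases i with κ | v <;> rcases j with l | w
  · rw [capS_outer_inl_inl hN hq hq0, Sum.elim_inl, neg_one_mul]
  · rw [capS_outer_inl_inr hN hq hq0, Sum.elim_inl, neg_one_mul]
  · rw [capS_outer_inr_inl hN hq hq0, Sum.elim_inr, one_mul]
  · rw [capS_outer_inr_inr hq hq0, Sum.elim_inr, one_mul]

/-! ## §4 Invertibility and the inverse bound `bCapO D` of the Schur complement -/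

/-- [folklore] The row sign is an involution. -/
theorem sign_mul_sign : diagonal (Sum.elim (fun _ : Fin D => (-1 : ℂ)) (fun _ : Unit => 1)) *
    diagonal (Sum.elim (fun _ : Fin D => (-1 : ℂ)) (fun _ : Unit => 1)) = 1 := by
  rw [diagonal_mul_diagonal, ← diagonal_one]
  congr 1
  funext i
  rcases i with κ | v <;> simp

/-- [folklore] The row sign has nonzero entries. -/
theorem sign_ne_zero (i : Fin D ⊕ Unit) : Sum.elim (fun _ : Fin D => (-1 : ℂ)) (fun _ : Unit => 1) i ≠ 0 := by
  rcases i with κ | v <;> simp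

/-- [folklore] **THE SCHUR COMPLEMENT IS INVERTIBLE** at the outer anchor. -/
theorem isUnit_capS_outer (hN : 1 ≤ N) (hq : ∀ i, |q i| ≤ π) (hq0 : q ≠ 0) :
    IsUnit (capS (outerArrow N q (ofRealVec q)).T (borU (outerArrow N q (ofRealVec q))) (borV (outerArrow N q (ofRealVec q)))) := by
  rw [capS_outer_eq hN hq hq0]
  exact (isUnit_diagonal_of_ne_zero sign_ne_zero).mul (isUnit_capSR hN hq hq0 (radO_pos hq hq0 0))

/-- [folklore] The inverse of the Schur complement: `capSR⁻¹ · diag(−1, +1)`. -/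
theorem inv_capS_outer (hN : 1 ≤ N) (hq : ∀ i, |q i| ≤ π) (hq0 : q ≠ 0) :
    (capS (outerArrow N q (ofRealVec q)).T (borU (outerArrow N q (ofRealVec q))) (borV (outerArrow N q (ofRealVec q))))⁻¹ =
      (capSR N q (radO N q 0))⁻¹ * diagonal (Sum.elim (fun _ : Fin D => (-1 : ℂ)) (fun _ : Unit => 1)) := by
  rw [capS_outer_eq hN hq hq0, Matrix.mul_inv_rev, Matrix.inv_eq_left_inv sign_mul_sign]

/-- [folklore] The inverse entries have the moduli of the entries of `capSR⁻¹`. -/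
theorem norm_inv_capS_outer_apply (hN : 1 ≤ N) (hq : ∀ i, |q i| ≤ π) (hq0 : q ≠ 0) (i j : Fin D ⊕ Unit) :
    ‖(capS (outerArrow N q (ofRealVec q)).T (borU (outerArrow N q (ofRealVec q))) (borV (outerArrow N q (ofRealVec q))))⁻¹ i j‖ =
      ‖(capSR N q (radO N q 0))⁻¹ i j‖ := by
  rw [inv_capS_outer hN hq hq0, mul_diagonal, norm_mul]
  rcases j with l | w <;> simp

/-- [folklore] **THE SCHUR INPUT OF ROW F5**: `IsUnit (capS …) ∧ ‖(capS …)⁻¹‖ ≤ bCapO D` at the outer anchor (`N ≥ 1`, `q ∈ [−π, π]^D ∖ {0}`),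
with leaf-12's `bCapO D = (π/2)²D²·cPP D + 2(π/2)³D·cPc D + (π/2)⁴·ccc D` (`ArrowAnchorRealCapRadius`, radius `r₀ = radO N q 0 ≥ (2/π)|q|₂`). -/
theorem capS_outer_ape (hN : 1 ≤ N) (hq : ∀ i, |q i| ≤ π) (hq0 : q ≠ 0) :
    IsUnit (capS (outerArrow N q (ofRealVec q)).T (borU (outerArrow N q (ofRealVec q))) (borV (outerArrow N q (ofRealVec q)))) ∧
      ‖(capS (outerArrow N q (ofRealVec q)).T (borU (outerArrow N q (ofRealVec q))) (borV (outerArrow N q (ofRealVec q))))⁻¹‖ ≤ bCapO D := by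
  classical
  refine ⟨isUnit_capS_outer hN hq hq0, (opNorm_le_sum_entries _).trans ?_⟩
  have hr0 : 2 / π * rad q ≤ radO N q 0 := two_div_pi_mul_rad_le_radO hN hq
  simp only [norm_inv_capS_outer_apply hN hq hq0, Fintype.sum_sum_type, Finset.sum_add_distrib]
  have h11 : ∑ κ : Fin D, ∑ l : Fin D, ‖(capSR N q (radO N q 0))⁻¹ (Sum.inl κ) (Sum.inl l)‖ ≤ (D : ℝ) ^ 2 * ((π / 2) ^ 2 * cPP D) := by
    calc ∑ κ : Fin D, ∑ l : Fin D, ‖(capSR N q (radO N q 0))⁻¹ (Sum.inl κ) (Sum.inl l)‖ ≤ ∑ _κ : Fin D, ∑ _l : Fin D, (π / 2) ^ 2 * cPP D :=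
          Finset.sum_le_sum fun κ _ => Finset.sum_le_sum fun l _ => norm_capSR_inv_inl_inl_le hN hq hq0 hr0 κ l
      _ = (D : ℝ) ^ 2 * ((π / 2) ^ 2 * cPP D) := by simp [Finset.sum_const, Finset.card_univ, Fintype.card_fin]; ring
  have h12 : ∑ κ : Fin D, ∑ u : Unit, ‖(capSR N q (radO N q 0))⁻¹ (Sum.inl κ) (Sum.inr u)‖ ≤ D * ((π / 2) ^ 3 * cPc D) := by
    calc ∑ κ : Fin D, ∑ u : Unit, ‖(capSR N q (radO N q 0))⁻¹ (Sum.inl κ) (Sum.inr u)‖ ≤ ∑ _κ : Fin D, ∑ _u : Unit, (π / 2) ^ 3 * cPc D :=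
          Finset.sum_le_sum fun κ _ => Finset.sum_le_sum fun u _ => norm_capSR_inv_inl_inr_le hN hq hq0 hr0 κ u
      _ = D * ((π / 2) ^ 3 * cPc D) := by simp [Finset.sum_const, Finset.card_univ, Fintype.card_fin]
  have h21 : ∑ u : Unit, ∑ l : Fin D, ‖(capSR N q (radO N q 0))⁻¹ (Sum.inr u) (Sum.inl l)‖ ≤ D * ((π / 2) ^ 3 * cPc D) := by
    calc ∑ u : Unit, ∑ l : Fin D, ‖(capSR N q (radO N q 0))⁻¹ (Sum.inr u) (Sum.inl l)‖ ≤ ∑ _u : Unit, ∑ _l : Fin D, (π / 2) ^ 3 * cPc D :=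
          Finset.sum_le_sum fun u _ => Finset.sum_le_sum fun l _ => norm_capSR_inv_inr_inl_le hN hq hq0 hr0 u l
      _ = D * ((π / 2) ^ 3 * cPc D) := by simp [Finset.sum_const, Finset.card_univ, Fintype.card_fin]
  have h22 : ∑ u : Unit, ∑ u' : Unit, ‖(capSR N q (radO N q 0))⁻¹ (Sum.inr u) (Sum.inr u')‖ ≤ (π / 2) ^ 4 * ccc D := by
    calc ∑ u : Unit, ∑ u' : Unit, ‖(capSR N q (radO N q 0))⁻¹ (Sum.inr u) (Sum.inr u')‖ ≤ ∑ _u : Unit, ∑ _u' : Unit, (π / 2) ^ 4 * ccc D :=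
          Finset.sum_le_sum fun u _ => Finset.sum_le_sum fun u' _ => norm_capSR_inv_inr_inr_le hN hq hq0 hr0 u u'
      _ = (π / 2) ^ 4 * ccc D := by simp
  unfold bCapO
  linarith

end Summit.QuantumFields.BalabanUV.Beta.GAN24.ArrowAnchorRealSchur

end
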